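import Summits.MatrixMultiplication.MatrixMultiplication.Theses.TropicalBiniPatterns

/-!
# TropicalBiniPatterns / `TropicalBrentNecessary` (stmt-MatrixMultiplication-8010)

Kapranov's necessary condition ("the minimum is attained twice") for an order-`h` approximate
decomposition `∑_ρ u_ρ ⊗ v_ρ ⊗ w_ρ = ε^h t + O(ε^{h+1})` over `ℂ[ε]` (`IsApproxDecomposition`,
Bläser 2013 Def. 6.1): at a cell `(a,b,c)` put `val ρ = tdeg u_ρ(a) + tdeg v_ρ(b) + tdeg w_ρ(c) ∈ ℕ∞`
(trailing degrees, `⊤` for the zero polynomial) and `m = min_ρ val ρ`.  Over a domain `val ρ` is the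
trailing degree of the product `u_ρ(a) v_ρ(b) w_ρ(c)`, so if the minimum `m` is attained by a single
`ρ`, the coefficient of `ε^m` in `∑_ρ u_ρ(a) v_ρ(b) w_ρ(c)` is that term's (non-zero) trailing
coefficient.  Hence: if `m < h`, or `m = h` and `t_{abc} = 0` (coefficient of `ε^m` vanishes), the
minimum is attained by two distinct `ρ`; and `t_{abc} ≠ 0` forces `m ≤ h` (otherwise the coefficient
of `ε^h` would vanish).  Elementary; the tropical-geometry reading is Maclagan–Sturmfels
(doi:10.1090/gsm/161) §3.1.
-/

set_option linter.dupNamespace false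

namespace Summit.MatrixMultiplication.MatrixMultiplication.Theorems

open scoped BigOperators Polynomial
open Polynomial

/-- **Minimum attained twice.**  For a finite family of polynomials `P ρ` over any semiring: if the
least trailing degree `n = min_ρ tdeg (P ρ)` is finite and the coefficient of `X^n` in `∑_ρ P ρ`
vanishes, then the minimum is attained by two distinct indices (a unique minimiser would contribute
its non-zero trailing coefficient and nothing else would). -/
theorem tropicalBrent_min_attained_twice {K : Type*} [Semiring K] {r : ℕ} (P : Fin r → K[X])
    (n : ℕ) (hn : Finset.univ.inf (fun ρ => (P ρ).trailingDegree) = (n : ℕ∞))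
    (h0 : (∑ ρ, P ρ).coeff n = 0) :
    ∃ ρ₁ ρ₂ : Fin r, ρ₁ ≠ ρ₂ ∧ (P ρ₁).trailingDegree = (n : ℕ∞) ∧
      (P ρ₂).trailingDegree = (n : ℕ∞) := by
  have hne : (Finset.univ : Finset (Fin r)).Nonempty := by
    rw [Finset.nonempty_iff_ne_empty]
    intro he
    rw [he, Finset.inf_empty] at hn
    exact WithTop.top_ne_natCast n hn
  obtain ⟨ρ₁, -, hρ₁⟩ := Finset.exists_mem_eq_inf Finset.univ hne fun ρ => (P ρ).trailingDegree
  have h₁ : (P ρ₁).trailingDegree = (n : ℕ∞) := hρ₁ ▸ hn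
  by_contra hcon
  -- every other term has trailing degree `> n`, so its `X^n`-coefficient vanishes
  have hothers : ∀ ρ, ρ ≠ ρ₁ → (P ρ).coeff n = 0 := by
    intro ρ hρ
    apply coeff_eq_zero_of_lt_trailingDegree
    have hle : (n : ℕ∞) ≤ (P ρ).trailingDegree :=
      hn ▸ Finset.inf_le (Finset.mem_univ ρ)
    exact lt_of_le_of_ne hle (fun h => hcon ⟨ρ₁, ρ, hρ.symm, h₁, h.symm⟩)
  have hsum : (∑ ρ, P ρ).coeff n = (P ρ₁).coeff n := by
    rw [finsetSum_coeff]
    exact Finset.sum_eq_single ρ₁ (fun ρ _ hρ => hothers ρ hρ) (fun h => (h (Finset.mem_univ _)).elim)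
  have hP₁ : P ρ₁ ≠ 0 := by
    intro h
    rw [h, trailingDegree_zero] at h₁
    exact WithTop.top_ne_natCast n h₁
  have hnat : (P ρ₁).natTrailingDegree = n := natTrailingDegree_eq_of_trailingDegree_eq_some h₁
  have hcoeff : (P ρ₁).coeff n ≠ 0 := by
    rw [← hnat]
    exact trailingCoeff_nonzero_iff_nonzero.2 hP₁
  exact hcoeff (hsum ▸ h0)

/-- **Order bound.**  For a finite family of polynomials `P ρ` over any semiring: if the coefficient
of `X^j` in `∑_ρ P ρ` is non-zero then `min_ρ tdeg (P ρ) ≤ j`. -/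
theorem tropicalBrent_inf_le_of_coeff_ne_zero {K : Type*} [Semiring K] {r : ℕ} (P : Fin r → K[X])
    (j : ℕ) (hj : (∑ ρ, P ρ).coeff j ≠ 0) :
    Finset.univ.inf (fun ρ => (P ρ).trailingDegree) ≤ (j : ℕ∞) := by
  by_contra hlt
  rw [not_le] at hlt
  apply hj
  rw [finsetSum_coeff]
  refine Finset.sum_eq_zero fun ρ _ => coeff_eq_zero_of_lt_trailingDegree ?_
  exact lt_of_lt_of_le hlt (Finset.inf_le (Finset.mem_univ ρ))

/-- **The tropical Brent conditions** (item `stmt-MatrixMultiplication-8010`, Kapranov's necessary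
condition for an order-`h` approximate decomposition over `ℂ[ε]`): with
`val ρ = tdeg u_ρ(a) + tdeg v_ρ(b) + tdeg w_ρ(c)` and `m = min_ρ val ρ`, at every cell `(a,b,c)`:
`m < h`, or `m = h` with `t_{abc} = 0`, forces the minimum to be attained by two distinct `ρ`; and
`t_{abc} ≠ 0` forces `m ≤ h`. -/
theorem tropicalBrentNecessary_proof :
    Summit.MatrixMultiplication.MatrixMultiplication.Theses.TropicalBiniPatterns.TropicalBrentNecessary := by
  unfold Summit.MatrixMultiplication.MatrixMultiplication.Theses.TropicalBiniPatterns.TropicalBrentNecessary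
  intro ι κ μ _ _ _ h r t u v w hd a b c val
  -- over the domain `ℂ`, `val ρ` is the trailing degree of the product
  set P : Fin r → ℂ[X] := fun ρ => u ρ a * v ρ b * w ρ c with hPdef
  have hval : ∀ ρ, val ρ = (P ρ).trailingDegree := by
    intro ρ
    simp only [val, hPdef, trailingDegree_mul]
  have hinf : Finset.univ.inf val = Finset.univ.inf (fun ρ => (P ρ).trailingDegree) :=
    congrArg _ (funext hval)
  have hsumP : (∑ ρ, u ρ a * v ρ b * w ρ c) = ∑ ρ, P ρ := rfl
  refine ⟨?_, ?_⟩
  · intro hyp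
    -- in both cases the minimum is a natural number `n ≤ h` at which the sum's coefficient vanishes
    obtain ⟨n, hn, h0⟩ : ∃ n : ℕ, Finset.univ.inf val = (n : ℕ∞) ∧ (∑ ρ, P ρ).coeff n = 0 := by
      rcases hyp with hlt | ⟨heq, ht⟩
      · have hne : Finset.univ.inf val ≠ ⊤ := ne_top_of_lt hlt
        refine ⟨(Finset.univ.inf val).toNat, (ENat.coe_toNat hne).symm, ?_⟩
        have hnh : (Finset.univ.inf val).toNat < h := by
          rw [← ENat.coe_toNat hne] at hlt
          exact_mod_cast hlt
        have := hd a b c _ hnh.le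
        rw [if_neg hnh.ne] at this
        exact hsumP ▸ this
      · refine ⟨h, heq, ?_⟩
        have := hd a b c h le_rfl
        rw [if_pos rfl, ht] at this
        exact hsumP ▸ this
    obtain ⟨ρ₁, ρ₂, hne, h₁, h₂⟩ := tropicalBrent_min_attained_twice P n (hinf ▸ hn) h0
    exact ⟨ρ₁, ρ₂, hne, by rw [hval, h₁, hn], by rw [hval, h₂, hn]⟩
  · intro ht
    have hcoeff : (∑ ρ, P ρ).coeff h ≠ 0 := by
      have := hd a b c h le_rfl
      rw [if_pos rfl] at this
      rw [← hsumP, this]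
      exact ht
    exact hinf ▸ tropicalBrent_inf_le_of_coeff_ne_zero P h hcoeff

end Summit.MatrixMultiplication.MatrixMultiplication.Theorems
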